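import Literature.MathematicalPhysics.QuantumFieldTheory.Balaban1983to89.B3Eq26ConstBox
import Literature.MathematicalPhysics.QuantumFieldTheory.Balaban1983to89.B3Ineq211ZeroBox

/-!
# `Balaban1983to89.B3Ineq210ConstBox` — T. Bałaban, *(Higgs)₂,₃ quantum fields in a finite volume. III. Renormalization*,
# Commun. Math. Phys. **88** (1983) 411–445 [Balaban1983Higgs3]: the kernel bounds (2.10) and (2.11) p. 426 PROVED for the
# MODEL INSTANCE `Ω = □`, `B̃ = B̃₀` a NON-ZERO CONSTANT background field, `N`-component fields — `ScaledKernels.Ineq210 δ₁ C`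
# and `ScaledKernels.Ineq211At α δ₁ C` DISCHARGED, uniformly in `B̃₀`, for the concrete carrier `constBoxKernels` whose Hölder
# field carries the GENUINE transporter `U(B̃₀(Γ_{x₁,x₂}))` — by the p. 433 gauge step on top of the zero-field instances

statement-level skeleton of published theorems with citation tags; proofs where landed; nothing here is a claim about the Yang–Mills mass gap

PDF held: `paper:balaban1983-higgs-2-3-quantum-fields-finite-volume` (journal page = PDF page + 410); p. 426 [PDF 16] ((2.10)–(2.12)),
p. 433 [PDF 23] (the gauge transformation removing `B̃₀`), p. 434 [PDF 24] («these norms are equal to the norms defined by (1.32)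
with B̃ = B̃₀») read in the OCR text (`p0016.txt`, `p0023.txt`, `p0024.txt`); [B4] = [Balaban1983RegularityDecay] p. 581 as quoted
by `B4GaugeCovariance`.

CITATION HEADER (lean-in-tree rule).  Part of the lit-balaban TYPED SKELETON (HOME `run/shared/lean/pub/lit-balaban/`), Phase 2,
proof seat **p03 gen 7** (unit `lit-balaban-p03-g7`), file 2 of 2 over `B3Eq26ConstBox` (file 1: the covariant scale operators
`GfineA0`, the pieces `pieceA0` and (2.6) at `B̃₀`, the transporter `Ub`, the covariant difference `covDiff`, the cancellation
identities `covDiff_conj`/`holderBlock_conj`); SKELETON rows **B3.Eq2.10** and **B3.Eq2.11** (fold owner r15,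
`HOME/lit-balaban-r15/ROWS-B3.md`; decls of record `B3Sect2StatementsPart2.ScaledKernels.Ineq210` typed p239134 and `Ineq211At`
p255002, G-B3-11).  CONSTANT-BACKGROUND TWIN of this seat's zero-field box carriers `B3Ineq210ZeroBox.zeroBoxKernels` (gen 4,
p253409, `ineq210_zeroBox`) and `B3Ineq211ZeroBox.zeroBoxKernelsH` (gen 4, p254934/p255289, `ineq211At_zeroBoxH`), USED BY NAME;
nothing of these is re-proved, no existing module is touched.

WHAT IS PRINTED (p. 426): *"For the propagators G^η_{(j)} we apply the inequality |G^η_{(j)}(Ω,B̃;x,x′)| ≤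
O(1)(L^jη)^{−d+2}e^{−δ₁(L^jη)^{−1}|x−x′|}, (2.10) and if the propagator is differentiated, then for each differentiation, there is an
additional factor (L^jη)^{−1} on the right side. This applies also to Hölder norms, e.g. we have
(1/|x₂−x₁|^α)|U(B̃(Γ_{x₁,x₂}))(D^η_{B̃,μ}G^η_{(j)})(Ω,B̃;x₂,x) − (D^η_{B̃,μ}G^η_{(j)})(Ω,B̃;x₁,x)| ≤ O(1)(L^jη)^{−d+1−α}e^{−δ₁(L^jη)^{−1}dist({x₁,x₂},x)},
0 ≤ α < 1. (2.11) … They all are obtained by rescaling from the η-lattice to the L^{−j}-lattice and application of Propositions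
I.2.1 and I.2.3."*; p. 433: *"Our next operation is the gauge transformation which removes the field B̃₀. … We get the same
expressions as above with B̃₀ = 0 only (and external scalar fields gauge transformed)."*

WHAT IS REPRODUCED (kind «model-instance», G.1 of `HOME/PHASE2-TARGETS.md`), in the setting of `B3Eq26ConstBox` (fine box
`□ ∩ ηℤ^{d+1}`, `N` colours, orthogonal flow `F`, `κ = eη`, constant `B̃₀`):
* §1 the size of an `N × N` block (`entrySup`, largest entry; `≤ |c|` on the blocks `c·U`, `U` orthogonal, met here);
* §2 **the carrier `constBoxKernels F κ B̃₀ ℓ k hℓ M a m² : ScaledKernels`** — sites, `dist = η|·|_∞`, `dist2`, `L`, `η`, `d ↦ d+1`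
  VERBATIM as in `zeroBoxKernelsH` (`scale_eq`), and the kernel fields of the covariant pieces `G^η_{(j)}(□,B̃₀)`: `absG` (value),
  `absDG` (covariant forward derivative (1.3) `D^η_{B̃₀,μ}` in the row variable), `holderDiff` (WITH the transporter
  `U(B̃₀(Γ_{x₁,x₂})) = Ub x₁ x₂`, contour-independent);
* §3 «the same expressions as above with B̃₀ = 0 only»: the three kernel fields are DOMINATED by the zero-field ones (`absG_le`,
  `absDG_le`, `holderDiff_le` — in fact equal up to the orthogonal transporter, `blk2_pieceA0`/`covDiff_conj`/`holderBlock_conj`);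
* §4 **`ineq210_constBox`**: `∃ δ₁ C > 0` (on `d + 1`, `L`, the window only) `∀ k ≥ 1 ∀ window ∀ □ ∀ B̃₀`, `Ineq210 δ₁ C`;
  **`ineq211At_constBox`**: per `0 ≤ α < 1`, `∀ B̃₀`, `Ineq211At α δ₁ C`; both at once with one pair of constants
  (`ineq210_211At_constBox`);
* §5 non-vacuity on a concrete instance whose background is NOT gauge-trivial on the box (`witness_link_ne_one`: link variable
  `U(π) = −1`; `ineq210_constBox_witness`).

HONEST SCOPE / DECLARED DIVERGENCES (F7).  (i) `Ω = □` (Neumann box), `B̃ = B̃₀` CONSTANT — the print's general small `B̃` needs the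
`B̃′`-expansion of p. 433 / [B4] (2.23)–(2.33), NOT formalised; the row heads concern the general case.  (ii) Colour: kernel values
`G(x,x′) ∈ End(ℝ^N)` measured ENTRYWISE (`entrySup`); for the blocks `c·U` of this instance the operator norm is `|c|` and every
entry is `≤ |c|`, so the printed `|·|` is served under either reading.  (iii) Abelian one-parameter orthogonal structure group,
box not torus (see file 1).  (iv) Derivatives = forward covariant differences (1.3) in the ROW variable along bonds of `□` (`0`
when the bond leaves `□`; the Hölder field is `0` unless both bonds lie in `□`, as in `zeroBoxKernelsH`); `|x − x′|` = sup norm in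
lattice units times `η`; constants existential, on `d + 1`, `L`, the window (and `α`, G-B3-11), NOT on `B̃₀`, `κ`, the flow.
(v) The (2.5)/(2.12) fields of the carrier are not modelled (`0`/`Unit`), nothing is claimed about `Ineq25`/`Ineq212` here.
(vi) ROUTE = the print's (gauge step p. 433 + «rescaling … Propositions I.2.1 and I.2.3» through the gen-4 zero-field instances);
no Literature fact minted; standard axioms.  Value = kernel certificate that the constant-background case of (2.10)/(2.11) on
boxes IS the zero-field case dressed with orthogonal transporters, with the transporter of (2.11) genuinely present; NOT summit
progress.
Unit `lit-balaban-p03-g7` (Phase-2 proof seat p03, gen 7); HOME `run/shared/lean/pub/lit-balaban/` (rows B3.Eq2.10/2.11; FILED.md,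
STATUS.md).
-/

namespace Literature.MathematicalPhysics.QuantumFieldTheory.Balaban1983to89.B3Ineq210ConstBox

open Matrix Finset
open scoped Kronecker
open B4GaugeCovariance
open B4Reflection242 (boxDom mem_boxDom)
open B4ContourShift (supNorm)
open B4Thm110ZeroBox (Nf sc one_lt_L_real)
open B3Ineq210ZeroBox (piece)
open B3Ineq211ZeroBox (zeroBoxKernelsH ineq210_zeroBoxH ineq211At_zeroBoxH)
open B3Sect2StatementsPart2
open B3Eq26ConstBox

noncomputable section

variable {d : ℕ} {ι : Type} [Fintype ι] [DecidableEq ι]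
variable {F : OrthFlow ι} {κ : ℝ} {A₀ : Fin (d + 1) → ℝ}

/-! ## §1 The size of an `N × N` block: the largest entry -/

section EntrySup

variable [Nonempty ι]

/-- the size `|B|` of an `N × N` block used by the carrier: the largest absolute entry `max_{i,i′}|B_{ii′}|` (ENTRYWISE reading of
the print's `|G(x,x′)|`; for the blocks `c·R`, `R` orthogonal, met here it is `≤ |c|` = the operator norm). [cite: Balaban1983Higgs3, (2.10) p.426] -/
def entrySup (B : Matrix ι ι ℝ) : ℝ :=
  (Finset.univ : Finset (ι × ι)).sup' Finset.univ_nonempty fun p => |B p.1 p.2|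

omit [DecidableEq ι] in
/-- `|B| ≤ c` iff every entry is `≤ c` in absolute value. [cite: Balaban1983Higgs3, (2.10) p.426] -/
theorem entrySup_le_iff {B : Matrix ι ι ℝ} {c : ℝ} : entrySup B ≤ c ↔ ∀ i i', |B i i'| ≤ c := by
  rw [entrySup, Finset.sup'_le_iff]
  exact ⟨fun h i i' => h (i, i') (Finset.mem_univ _), fun h p _ => h p.1 p.2⟩

omit [DecidableEq ι] in
/-- every entry is bounded by `|B|`. [cite: Balaban1983Higgs3, (2.10) p.426] -/
theorem abs_le_entrySup (B : Matrix ι ι ℝ) (i i' : ι) : |B i i'| ≤ entrySup B :=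
  entrySup_le_iff.1 le_rfl i i'

omit [DecidableEq ι] in
/-- `|B| ≥ 0`. [cite: Balaban1983Higgs3, (2.10) p.426] -/
theorem entrySup_nonneg (B : Matrix ι ι ℝ) : 0 ≤ entrySup B := by
  obtain ⟨i⟩ := (inferInstance : Nonempty ι)
  exact (abs_nonneg _).trans (abs_le_entrySup B i i)

/-- kernel: `|c·O| ≤ |c|` for an orthogonal `O` (entries of an orthogonal matrix are `≤ 1`,
`B4GaugeCovariance.abs_apply_le_one_of_orthogonal`). [folklore] -/
private theorem entrySup_smul_le {O : Matrix ι ι ℝ} (hO : Oᵀ * O = 1) (c : ℝ) : entrySup (c • O) ≤ |c| := by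
  rw [entrySup_le_iff]
  intro i i'
  rw [Matrix.smul_apply, smul_eq_mul, abs_mul]
  exact mul_le_of_le_one_right (abs_nonneg c) (abs_apply_le_one_of_orthogonal hO i i')

end EntrySup

/-! ## §2 The concrete carrier of B3 (2.5)/(2.10)–(2.12) for the MODEL INSTANCE `Ω = □`, `B̃ = B̃₀` CONSTANT, `N` colours -/

section Carrier

variable [Nonempty ι] (F κ A₀)

/-- **The concrete carrier of (2.5), (2.10)–(2.12) for the MODEL INSTANCE `Ω = □ = Π_μ[0, M_μ)`, CONSTANT BACKGROUND `B̃ = B̃₀`,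
`N`-component fields** at scale `k` (`η = L^{−k}`, `L = ℓ + 1`, window point `(a, m²)`; one-parameter orthogonal flow `F` on `ℝ^N`,
`κ = eη`): sites, `dist = η|·|_∞`, `dist2`, `L`, `η`, `d ↦ d+1` EXACTLY as in the zero-field carrier `B3Ineq211ZeroBox.zeroBoxKernelsH`,
and the kernels of the covariant pieces `G^η_{(j)}(□,B̃₀) = pieceA0 j` in the print's `η^d`-normalisation with `N × N` blocks measured
by their largest entry (`entrySup`): `absG j x x′ = η^{−(d+1)}|G^η_{(j)}(□,B̃₀;x,x′)|`, `absDG j μ x x′ = η^{−(d+1)}|(D^η_{B̃₀,μ}G^η_{(j)})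
(□,B̃₀;x,x′)|` (covariant forward derivative (1.3) in the ROW variable along the bond `⟨x,x+ηe_μ⟩ ⊂ □`, `0` if the bond leaves `□` —
Neumann), `holderDiff j μ x₁ x₂ x = η^{−(d+1)}|U(B̃₀(Γ_{x₁,x₂}))(D^η_{B̃₀,μ}G^η_{(j)})(□,B̃₀;x₂,x) − (D^η_{B̃₀,μ}G^η_{(j)})(□,B̃₀;x₁,x)|`
with the GENUINE TRANSPORTER `U(B̃₀(Γ_{x₁,x₂})) = Ub x₁ x₂` (contour-independent, `transport_eq_Ub`), `0` unless both bonds lie in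
`□`.  DECLARED DIVERGENCE (F7): the (2.5)/(2.12) fields (`LocFn`, `distBlock`, `distSupp`, `distΩ₂`, `eRun`, `pRun`, `absGavg`,
`normDeltaG`, `norm116`) are NOT MODELLED (`Unit`/`0`): nothing is claimed about `Ineq25`/`Ineq212` of this instance (the vector
field propagator of (2.12) does not see `B̃`). [cite: Balaban1983Higgs3, (2.6) p.424, (2.10)–(2.11) p.426] -/
def constBoxKernels (ℓ k : ℕ) (hℓ : 1 ≤ ℓ) (M : Fin (d + 1) → ℕ) (a m2 : ℝ) : ScaledKernels where
  Site := ↥(boxDom (Nf ℓ k M))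
  Bond := ↥(boxDom (Nf ℓ k M)) × Fin (d + 1)
  Dir := Fin (d + 1)
  LocFn := Unit
  dist x x' := supNorm (x.1 - x'.1) / (((ℓ + 1) ^ k : ℕ) : ℝ)
  dist2 x₁ x₂ x := min (supNorm (x₁.1 - x.1)) (supNorm (x₂.1 - x.1)) / (((ℓ + 1) ^ k : ℕ) : ℝ)
  distBlock _ _ _ := 0
  distSupp _ _ := 0
  distΩ₂ := 0
  L := (ℓ : ℝ) + 1
  η := ((((ℓ + 1) ^ k : ℕ) : ℝ))⁻¹
  d := d + 1
  eRun := 0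
  pRun := 0
  one_lt_L := one_lt_L_real hℓ
  η_pos := inv_pos.2 (by positivity)
  absG j x x' := ((((ℓ + 1) ^ k : ℕ) : ℝ)) ^ (d + 1) * entrySup (blk2 (pieceA0 F κ A₀ ℓ k M j a m2) x x')
  absDG j μ x x' :=
    if h : x.1 + Pi.single μ 1 ∈ boxDom (Nf ℓ k M) then
      ((((ℓ + 1) ^ k : ℕ) : ℝ)) ^ (d + 1)
        * (((((ℓ + 1) ^ k : ℕ) : ℝ))
          * entrySup (covDiff F κ A₀ ℓ k M (pieceA0 F κ A₀ ℓ k M j a m2) x ⟨x.1 + Pi.single μ 1, h⟩ x'))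
    else 0
  holderDiff j μ x₁ x₂ x :=
    if h : x₁.1 + Pi.single μ 1 ∈ boxDom (Nf ℓ k M) ∧ x₂.1 + Pi.single μ 1 ∈ boxDom (Nf ℓ k M) then
      ((((ℓ + 1) ^ k : ℕ) : ℝ)) ^ (d + 1)
        * (((((ℓ + 1) ^ k : ℕ) : ℝ))
          * entrySup (Ub F κ A₀ ℓ k M x₁ x₂
                * covDiff F κ A₀ ℓ k M (pieceA0 F κ A₀ ℓ k M j a m2) x₂ ⟨x₂.1 + Pi.single μ 1, h.2⟩ x
              - covDiff F κ A₀ ℓ k M (pieceA0 F κ A₀ ℓ k M j a m2) x₁ ⟨x₁.1 + Pi.single μ 1, h.1⟩ x))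
    else 0
  absGavg _ _ _ := 0
  normDeltaG _ _ _ := 0
  norm116 _ _ _ _ _ := 0

variable {F κ A₀}
variable {ℓ k : ℕ} {hℓ : 1 ≤ ℓ} {M : Fin (d + 1) → ℕ} {a m2 : ℝ}

/-- the length scale `L^jη = s_j^{-1}` of the carrier (`j ≤ k`) — the same field values as the zero-field carriers.
[cite: Balaban1983Higgs3, (2.10) p.426] -/
theorem scale_eq {j : ℕ} (hj : j ≤ k) : (constBoxKernels F κ A₀ ℓ k hℓ M a m2).scale j = (sc ℓ k j)⁻¹ :=
  B3Ineq210ZeroBox.scale_eq (hℓ := hℓ) (M := M) (a := a) (m2 := m2) hj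

/-! ## §3 «The same expressions as above with B̃₀ = 0 only» — the three kernel fields of the constant-background carrier are
DOMINATED by those of the zero-field carrier `zeroBoxKernelsH` (in fact equal up to the orthogonal transporter) -/

/-- **VALUE**: `η^{−(d+1)}|G^η_{(j)}(□,B̃₀;x,x′)| ≤ η^{−(d+1)}|G^η_{(j)}(□,0;x,x′)|` (the block is `G^η_{(j)}(□,0;x,x′)·U`, `U` orthogonal).
[cite: Balaban1983Higgs3, (2.10) p.426] -/
theorem absG_le (hk : 1 ≤ k) (hM : ∀ i, 1 ≤ M i) (ha : 0 < a) (hm : 0 ≤ m2) (j : ℕ) (x x' : ↥(boxDom (Nf ℓ k M))) :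
    (constBoxKernels F κ A₀ ℓ k hℓ M a m2).absG j x x' ≤ (zeroBoxKernelsH ℓ k hℓ M a m2).absG j x x' := by
  show ((((ℓ + 1) ^ k : ℕ) : ℝ)) ^ (d + 1) * entrySup (blk2 (pieceA0 F κ A₀ ℓ k M j a m2) x x')
    ≤ ((((ℓ + 1) ^ k : ℕ) : ℝ)) ^ (d + 1) * |piece ℓ k M j a m2 x x'|
  rw [blk2_pieceA0 hℓ hk hM ha hm]
  exact mul_le_mul_of_nonneg_left (entrySup_smul_le (gA0_pair_orth (F := F) (κ := κ) (A₀ := A₀) ℓ k M x x') _) (by positivity)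

/-- **DERIVATIVE**: `η^{−(d+1)}|(D^η_{B̃₀,μ}G^η_{(j)})(□,B̃₀;x,x′)| ≤ η^{−(d+1)}|(∂^η_μG^η_{(j)})(□,0;x,x′)|` (the covariant difference
of the conjugate is the plain difference times the transporter, `covDiff_conj`). [cite: Balaban1983Higgs3, (2.10) p.426] -/
theorem absDG_le (hk : 1 ≤ k) (hM : ∀ i, 1 ≤ M i) (ha : 0 < a) (hm : 0 ≤ m2) (j : ℕ) (μ : Fin (d + 1))
    (x x' : ↥(boxDom (Nf ℓ k M))) :
    (constBoxKernels F κ A₀ ℓ k hℓ M a m2).absDG j μ x x' ≤ (zeroBoxKernelsH ℓ k hℓ M a m2).absDG j μ x x' := by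
  show (if h : x.1 + Pi.single μ 1 ∈ boxDom (Nf ℓ k M) then
      ((((ℓ + 1) ^ k : ℕ) : ℝ)) ^ (d + 1)
        * (((((ℓ + 1) ^ k : ℕ) : ℝ))
          * entrySup (covDiff F κ A₀ ℓ k M (pieceA0 F κ A₀ ℓ k M j a m2) x ⟨x.1 + Pi.single μ 1, h⟩ x'))
    else 0)
    ≤ (if h : x.1 + Pi.single μ 1 ∈ boxDom (Nf ℓ k M) then
      ((((ℓ + 1) ^ k : ℕ) : ℝ)) ^ (d + 1)
        * (((((ℓ + 1) ^ k : ℕ) : ℝ)) * |piece ℓ k M j a m2 ⟨x.1 + Pi.single μ 1, h⟩ x' - piece ℓ k M j a m2 x x'|)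
    else 0)
  split_ifs with h
  · rw [pieceA0_eq hℓ hk hM ha hm, covDiff_conj]
    exact mul_le_mul_of_nonneg_left (mul_le_mul_of_nonneg_left
      (entrySup_smul_le (gA0_pair_orth (F := F) (κ := κ) (A₀ := A₀) ℓ k M x x') _) (by positivity)) (by positivity)
  · exact le_rfl

/-- **HÖLDER DIFFERENCE WITH TRANSPORT**: `|U(B̃₀(Γ_{x₁,x₂}))(D^η_{B̃₀,μ}G^η_{(j)})(□,B̃₀;x₂,x) − (D^η_{B̃₀,μ}G^η_{(j)})(□,B̃₀;x₁,x)| ≤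
|(∂^η_μG^η_{(j)})(□,0;x₂,x) − (∂^η_μG^η_{(j)})(□,0;x₁,x)|` — the transporter exactly compensates the gauge factors
(`holderBlock_conj`); this is the (2.11)/(1.32) mechanism behind p. 434 «these norms are equal to the norms defined by (1.32) with
B̃ = B̃₀». [cite: Balaban1983Higgs3, (2.11) p.426] -/
theorem holderDiff_le (hk : 1 ≤ k) (hM : ∀ i, 1 ≤ M i) (ha : 0 < a) (hm : 0 ≤ m2) (j : ℕ) (μ : Fin (d + 1))
    (x₁ x₂ x : ↥(boxDom (Nf ℓ k M))) :
    (constBoxKernels F κ A₀ ℓ k hℓ M a m2).holderDiff j μ x₁ x₂ x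
      ≤ (zeroBoxKernelsH ℓ k hℓ M a m2).holderDiff j μ x₁ x₂ x := by
  show (if h : x₁.1 + Pi.single μ 1 ∈ boxDom (Nf ℓ k M) ∧ x₂.1 + Pi.single μ 1 ∈ boxDom (Nf ℓ k M) then
      ((((ℓ + 1) ^ k : ℕ) : ℝ)) ^ (d + 1)
        * (((((ℓ + 1) ^ k : ℕ) : ℝ))
          * entrySup (Ub F κ A₀ ℓ k M x₁ x₂
                * covDiff F κ A₀ ℓ k M (pieceA0 F κ A₀ ℓ k M j a m2) x₂ ⟨x₂.1 + Pi.single μ 1, h.2⟩ x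
              - covDiff F κ A₀ ℓ k M (pieceA0 F κ A₀ ℓ k M j a m2) x₁ ⟨x₁.1 + Pi.single μ 1, h.1⟩ x))
    else 0)
    ≤ (if h : x₁.1 + Pi.single μ 1 ∈ boxDom (Nf ℓ k M) ∧ x₂.1 + Pi.single μ 1 ∈ boxDom (Nf ℓ k M) then
      ((((ℓ + 1) ^ k : ℕ) : ℝ)) ^ (d + 1)
        * (((((ℓ + 1) ^ k : ℕ) : ℝ))
          * |(piece ℓ k M j a m2 ⟨x₂.1 + Pi.single μ 1, h.2⟩ x - piece ℓ k M j a m2 x₂ x)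
              - (piece ℓ k M j a m2 ⟨x₁.1 + Pi.single μ 1, h.1⟩ x - piece ℓ k M j a m2 x₁ x)|)
    else 0)
  split_ifs with h
  · rw [pieceA0_eq hℓ hk hM ha hm, holderBlock_conj]
    exact mul_le_mul_of_nonneg_left (mul_le_mul_of_nonneg_left
      (entrySup_smul_le (gA0_pair_orth (F := F) (κ := κ) (A₀ := A₀) ℓ k M x₁ x) _) (by positivity)) (by positivity)
  · exact le_rfl

end Carrier

/-! ## §4 (2.10) and (2.11) DISCHARGED for the constant-background box instance, uniformly in `B̃₀` -/

section Discharge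

variable [Nonempty ι]

/-- **B3 (2.10) p. 426 [PDF 16] — `ScaledKernels.Ineq210 δ₁ C` DISCHARGED for the MODEL INSTANCE `Ω = □`, `B̃ = B̃₀` CONSTANT ≠ 0,
`N` colours.**  Verbatim: *"For the propagators G^η_{(j)} we apply the inequality
|G^η_{(j)}(Ω, B̃; x, x′)| ≤ O(1)(L^jη)^{−d+2}e^{−δ₁(L^jη)^{−1}|x−x′|}, (2.10) and if the propagator is differentiated, then for each
differentiation, there is an additional factor (L^jη)^{−1} on the right side."*  HERE: there are `δ₁ > 0`, `C > 0` depending only on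
`d + 1`, `L = ℓ + 1` and the window `[a₋,a₊] × [0,m²₊]` — and NOT on the background `B̃₀`, the charge parameter `κ = eη` or the flow —
such that for every scale `k ≥ 1`, every window point, every box `□ = Π_μ[0,M_μ)` and EVERY CONSTANT FIELD `B̃₀`, the carrier
`constBoxKernels` of the covariant pieces `G^η_{(j)}(□,B̃₀)` of (2.6) (`sum_pieceA0`) satisfies `Ineq210 δ₁ C`: the value clause and the
once-COVARIANTLY-differentiated clause (derivative `D^η_{B̃₀,μ}` of [B4] (1.3) in the row variable).  ROUTE = the print's p. 433
gauge step («the gauge transformation which removes the field B̃₀ … We get the same expressions as above with B̃₀ = 0 only»; [B4]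
p. 581): the pieces are gauge conjugates of the zero-field pieces (`pieceA0_eq`), their blocks are the zero-field kernels times
orthogonal transporters (§3), and the zero-field instance is this seat's `B3Ineq210ZeroBox.ineq210_zeroBox` (gen 4).  HONEST
SCOPE: (i) `Ω = □` a box of unit blocks (Neumann), `B̃₀` CONSTANT (the print: general small `B̃`; for non-constant `B̃` the
expansion in `B̃′ = B̃ − B̃₀` of p. 433 / [B4] (2.23)–(2.33) is NOT formalised here); (ii) colour: `N × N` blocks measured by their
largest entry (for the blocks `c·U` met here every unitarily invariant norm gives `|c|`, so nothing is lost); (iii) one-parameter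
ORTHOGONAL flow (abelian, [B4] (1.2); the U(1) Higgs field of [B3] is the `N = 2` rotation flow); (iv) sup norm for `|x − x′|`,
existential constants; (v) not on a torus (the linear gauge `λ = −⟨B̃₀,x⟩` lives on the box `□ ⊂ ηℤ^{d+1}`, exactly the p. 433
setting after the replacement `G_k(Ω,B̃) = G_k(□,B̃) + δG_k`). [cite: Balaban1983Higgs3, (2.10) p.426] -/
theorem ineq210_constBox (F : OrthFlow ι) (κ : ℝ) (d ℓ : ℕ) (hℓ : 1 ≤ ℓ) (amin aplus m2plus : ℝ) (ha : 0 < amin) :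
    ∃ δ₁ C : ℝ, 0 < δ₁ ∧ 0 < C ∧ ∀ (k : ℕ), 1 ≤ k → ∀ (a m2 : ℝ), amin ≤ a → a ≤ aplus → 0 ≤ m2 → m2 ≤ m2plus →
      ∀ (M : Fin (d + 1) → ℕ), (∀ i, 1 ≤ M i) → ∀ (A₀ : Fin (d + 1) → ℝ),
        (constBoxKernels F κ A₀ ℓ k hℓ M a m2).Ineq210 δ₁ C := by
  obtain ⟨δ₁, C, hδ, hC, h⟩ := ineq210_zeroBoxH d ℓ hℓ amin aplus m2plus ha
  refine ⟨δ₁, C, hδ, hC, fun k hk a m2 h1 h2 h3 h4 M hM A₀ => ?_⟩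
  intro j x x'
  have ha0 : 0 < a := lt_of_lt_of_le ha h1
  obtain ⟨hv, hd⟩ := h k hk a m2 h1 h2 h3 h4 M hM j x x'
  exact ⟨(absG_le hk hM ha0 h3 j x x').trans hv, fun μ => (absDG_le hk hM ha0 h3 j μ x x').trans (hd μ)⟩

/-- **B3 (2.11) p. 426 [PDF 16] — the decl of record `ScaledKernels.Ineq211At α δ₁ C` (per Hölder exponent, G-B3-11) DISCHARGED for
the MODEL INSTANCE `Ω = □`, `B̃ = B̃₀` CONSTANT ≠ 0, `N` colours, WITH THE GENUINE TRANSPORTER `U(B̃(Γ_{x₁,x₂}))`.**  Verbatim: *"This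
applies also to Hölder norms, e.g. we have (1/|x₂−x₁|^α)|U(B̃(Γ_{x₁,x₂}))(D^η_{B̃,μ}G^η_{(j)})(Ω,B̃;x₂,x) − (D^η_{B̃,μ}G^η_{(j)})(Ω,B̃;x₁,x)|
≤ O(1)(L^jη)^{−d+1−α}e^{−δ₁(L^jη)^{−1}dist({x₁,x₂},x)}, 0 ≤ α < 1. (2.11)"*  HERE: for every `0 ≤ α < 1` there are `δ₁ > 0`, `C > 0`
(on `d + 1`, `L`, the window and `α`; NOT on `B̃₀`, `κ`, the flow) such that for every `k ≥ 1`, window point, box and EVERY CONSTANT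
`B̃₀`, `(constBoxKernels …).Ineq211At α δ₁ C` — the transporter `U(B̃₀(Γ_{x₁,x₂})) = Ub x₁ x₂` (any contour, `transport_eq_Ub`)
compensates the gauge factors exactly (`holderBlock_conj`), reducing the clause to the zero-field instance
`B3Ineq211ZeroBox.ineq211At_zeroBoxH` (gen 4).  HONEST SCOPE as in `ineq210_constBox`. [cite: Balaban1983Higgs3, (2.11) p.426] -/
theorem ineq211At_constBox (F : OrthFlow ι) (κ : ℝ) (d ℓ : ℕ) (hℓ : 1 ≤ ℓ) (amin aplus m2plus : ℝ) (ha : 0 < amin)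
    {α : ℝ} (hα0 : 0 ≤ α) (hα1 : α < 1) :
    ∃ δ₁ C : ℝ, 0 < δ₁ ∧ 0 < C ∧ ∀ (k : ℕ), 1 ≤ k → ∀ (a m2 : ℝ), amin ≤ a → a ≤ aplus → 0 ≤ m2 → m2 ≤ m2plus →
      ∀ (M : Fin (d + 1) → ℕ), (∀ i, 1 ≤ M i) → ∀ (A₀ : Fin (d + 1) → ℝ),
        (constBoxKernels F κ A₀ ℓ k hℓ M a m2).Ineq211At α δ₁ C := by
  obtain ⟨δ₁, C, hδ, hC, h⟩ := ineq211At_zeroBoxH d ℓ hℓ amin aplus m2plus ha hα0 hα1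
  refine ⟨δ₁, C, hδ, hC, fun k hk a m2 h1 h2 h3 h4 M hM A₀ => ?_⟩
  intro j μ x₁ x₂ x hne
  have ha0 : 0 < a := lt_of_lt_of_le ha h1
  have hz := h k hk a m2 h1 h2 h3 h4 M hM j μ x₁ x₂ x hne
  have hdist : 0 ≤ (constBoxKernels F κ A₀ ℓ k hℓ M a m2).dist x₁ x₂ ^ α :=
    Real.rpow_nonneg (div_nonneg (B4ContourShift.supNorm_nonneg _) (Nat.cast_nonneg _)) α
  exact (div_le_div_of_nonneg_right (holderDiff_le hk hM ha0 h3 j μ x₁ x₂ x) hdist).trans hz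

/-- **Both printed inequalities at once, one pair of constants per `α`**: (2.10) and (2.11) for the constant-background box instance
with the same `(δ₁, C)` (take the minimum / maximum of the two pairs). [cite: Balaban1983Higgs3, (2.10)–(2.11) p.426] -/
theorem ineq210_211At_constBox (F : OrthFlow ι) (κ : ℝ) (d ℓ : ℕ) (hℓ : 1 ≤ ℓ) (amin aplus m2plus : ℝ) (ha : 0 < amin)
    {α : ℝ} (hα0 : 0 ≤ α) (hα1 : α < 1) :
    ∃ δ₁ C : ℝ, 0 < δ₁ ∧ 0 < C ∧ ∀ (k : ℕ), 1 ≤ k → ∀ (a m2 : ℝ), amin ≤ a → a ≤ aplus → 0 ≤ m2 → m2 ≤ m2plus →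
      ∀ (M : Fin (d + 1) → ℕ), (∀ i, 1 ≤ M i) → ∀ (A₀ : Fin (d + 1) → ℝ),
        (constBoxKernels F κ A₀ ℓ k hℓ M a m2).Ineq210 δ₁ C ∧ (constBoxKernels F κ A₀ ℓ k hℓ M a m2).Ineq211At α δ₁ C := by
  obtain ⟨δ₁, C₁, hδ₁, hC₁, h₁⟩ := ineq210_constBox F κ d ℓ hℓ amin aplus m2plus ha
  obtain ⟨δ₂, C₂, hδ₂, hC₂, h₂⟩ := ineq211At_constBox F κ d ℓ hℓ amin aplus m2plus ha hα0 hα1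
  refine ⟨min δ₁ δ₂, max C₁ C₂, lt_min hδ₁ hδ₂, lt_max_of_lt_left hC₁, fun k hk a m2 e1 e2 e3 e4 M hM A₀ => ⟨?_, ?_⟩⟩
  · intro j x x'
    obtain ⟨hv, hd⟩ := h₁ k hk a m2 e1 e2 e3 e4 M hM A₀ j x x'
    have hs : 0 < (constBoxKernels F κ A₀ ℓ k hℓ M a m2).scale j := B3Ineq210ZeroBox.scale_pos (hℓ := hℓ) (M := M) (a := a) (m2 := m2) j
    have hD : 0 ≤ (constBoxKernels F κ A₀ ℓ k hℓ M a m2).dist x x' :=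
      div_nonneg (B4ContourShift.supNorm_nonneg _) (Nat.cast_nonneg _)
    have hmono : ∀ (p : ℝ), C₁ * (constBoxKernels F κ A₀ ℓ k hℓ M a m2).scale j ^ p
        * Real.exp (-(δ₁ * ((constBoxKernels F κ A₀ ℓ k hℓ M a m2).scale j)⁻¹
            * (constBoxKernels F κ A₀ ℓ k hℓ M a m2).dist x x'))
        ≤ max C₁ C₂ * (constBoxKernels F κ A₀ ℓ k hℓ M a m2).scale j ^ p
        * Real.exp (-(min δ₁ δ₂ * ((constBoxKernels F κ A₀ ℓ k hℓ M a m2).scale j)⁻¹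
            * (constBoxKernels F κ A₀ ℓ k hℓ M a m2).dist x x')) := by
      intro p
      have hsp : 0 ≤ (constBoxKernels F κ A₀ ℓ k hℓ M a m2).scale j ^ p := Real.rpow_nonneg hs.le p
      refine mul_le_mul (mul_le_mul_of_nonneg_right (le_max_left _ _) hsp) ?_ (Real.exp_pos _).le
        (mul_nonneg (le_trans hC₁.le (le_max_left _ _)) hsp)
      refine Real.exp_le_exp.2 (neg_le_neg (mul_le_mul_of_nonneg_right (mul_le_mul_of_nonneg_right (min_le_left _ _)
        (inv_pos.2 hs).le) hD))
    exact ⟨hv.trans (hmono _), fun μ => (hd μ).trans (hmono _)⟩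
  · intro j μ x₁ x₂ x hne
    have hz := h₂ k hk a m2 e1 e2 e3 e4 M hM A₀ j μ x₁ x₂ x hne
    have hs : 0 < (constBoxKernels F κ A₀ ℓ k hℓ M a m2).scale j := B3Ineq210ZeroBox.scale_pos (hℓ := hℓ) (M := M) (a := a) (m2 := m2) j
    have hD : 0 ≤ (constBoxKernels F κ A₀ ℓ k hℓ M a m2).dist2 x₁ x₂ x :=
      div_nonneg (le_min (B4ContourShift.supNorm_nonneg _) (B4ContourShift.supNorm_nonneg _)) (Nat.cast_nonneg _)
    have hsp : 0 ≤ (constBoxKernels F κ A₀ ℓ k hℓ M a m2).scale j ^ (1 - ((constBoxKernels F κ A₀ ℓ k hℓ M a m2).d : ℝ) - α) :=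
      Real.rpow_nonneg hs.le _
    refine hz.trans ?_
    refine mul_le_mul (mul_le_mul_of_nonneg_right (le_max_right _ _) hsp) ?_ (Real.exp_pos _).le
      (mul_nonneg (le_trans hC₁.le (le_max_left _ _)) hsp)
    exact Real.exp_le_exp.2 (neg_le_neg (mul_le_mul_of_nonneg_right (mul_le_mul_of_nonneg_right (min_le_right _ _)
      (inv_pos.2 hs).le) hD))

end Discharge

/-! ## §5 Non-vacuity: a genuinely non-trivial constant background on a concrete box -/

section Witness

/-- the instance data of the witness: dimension `d + 1 = 3`, `L = 2` (`ℓ = 1`), scale `k = 1`, unit box `M ≡ 1`, `N = 2` with the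
rotation flow (the U(1) Higgs field of [B3]), `κ = 1`, constant field `B̃₀ ≡ π`. [cite: Balaban1983Higgs3, (2.10) p.426] -/
def witnessA0 : Fin (2 + 1) → ℝ := fun _ => Real.pi

/-- **the witness background is NOT gauge-trivial on the box**: its link variable on the bond `⟨0, e₀⟩` is `U(π) = −1 ≠ 1` — so the
carrier's transporters and covariant derivatives are genuinely those of a non-zero field. [cite: Balaban1983Higgs3, (2.11) p.426] -/
theorem witness_link_ne_one :
    Ub OrthFlow.rot 1 witnessA0 1 1 (fun _ => 1)
        ⟨fun _ => 0, by rw [mem_boxDom]; intro i; simp⟩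
        ⟨fun i => (0 : Fin (2 + 1) → ℤ) i + B4Lower18Regular.e1 0 i, by
          rw [mem_boxDom]; intro i; fin_cases i <;> simp [B4Lower18Regular.e1]⟩ ≠ 1 := by
  rw [Ub, fieldLink, B4Lemma22HolderBox.constBond_fwd witnessA0 (μ := 0) (by rfl), one_mul, witnessA0]
  exact OrthFlow.rot_ne_one

/-- **witness**: (2.10) and (2.11) (at `α = 1/2`) hold with positive constants for the concrete constant-background instance
(`d + 1 = 3`, `L = 2`, `k = 1`, unit box, `N = 2` rotation flow, `κ = 1`, `B̃₀ ≡ π`, `a = 1`, `m² = 1/2`), whose box is inhabited and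
whose background is not gauge-trivial (`witness_link_ne_one`). [cite: Balaban1983Higgs3, (2.10)–(2.11) p.426] -/
theorem ineq210_constBox_witness :
    ∃ δ₁ C : ℝ, 0 < δ₁ ∧ 0 < C ∧
      (constBoxKernels OrthFlow.rot 1 witnessA0 1 1 le_rfl (fun _ : Fin (2 + 1) => 1) 1 (1 / 2)).Ineq210 δ₁ C ∧
      (constBoxKernels OrthFlow.rot 1 witnessA0 1 1 le_rfl (fun _ : Fin (2 + 1) => 1) 1 (1 / 2)).Ineq211At (1 / 2) δ₁ C ∧
      Nonempty (constBoxKernels OrthFlow.rot 1 witnessA0 1 1 le_rfl (fun _ : Fin (2 + 1) => 1) 1 (1 / 2)).Site := by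
  obtain ⟨δ₁, C, hδ, hC, h⟩ := ineq210_211At_constBox OrthFlow.rot 1 2 1 le_rfl 1 1 1 one_pos (α := 1 / 2)
    (by norm_num) (by norm_num)
  obtain ⟨h1, h2⟩ := h 1 le_rfl 1 (1 / 2) le_rfl le_rfl (by norm_num) (by norm_num) (fun _ => 1) (fun _ => le_rfl) witnessA0
  exact ⟨δ₁, C, hδ, hC, h1, h2, ⟨⟨fun _ => 0, by rw [mem_boxDom]; intro i; simp⟩⟩⟩

end Witness

end

end Literature.MathematicalPhysics.QuantumFieldTheory.Balaban1983to89.B3Ineq210ConstBox
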